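import Literature.AlgebraicGeometry.Resolution.Lipman1969IntersectionTheoryRational
import HarnessLib

/-!
# `(D·E) = h⁰(E) + h⁰(𝒪_D) − h⁰(𝒪_{D+E})` for every effective exceptional divisor `D` (Lipman 1969, Prop. (13.1) d))

Topic: `Literature/AlgebraicGeometry/Resolution`.  PROVED, fact-free, definition-free.  J. Lipman, *Rational
singularities …*, Publ. Math. IHÉS 36 (1969), §13 Prop. (13.1) d) (p. 223): "`(F·E) = χ(E) + χ(F) − χ(E+F)`" for CURVES
`E`, `F` with exceptional support — `F` need not be integral.  The tree's `Lipman1969_13_1_d_rat` is the case of two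
integral curves; here, on a resolution `π : X → Spec A` of a two-dimensional Noetherian local domain with
`H¹(X, 𝒪_X) = 0`, the formula for `E = E_η` integral and `F = D` ANY effective exceptional divisor
`𝓛_t = ∏_{ζ∈t} 𝓘_ζ` (multiset `t` of integral exceptional curves, repetitions allowed):

  `(D·E_η) = excCurveDegree π [𝓛_t] η = h0 𝓘_η + h0 𝓛_t − h0 (𝓛_t 𝓘_η)`,

from the additivity `Δ_E(𝓛𝓘_ζ) − Δ_E(𝓛) = Δ_E(𝓘_ζ) − Δ_E(1)` (`Resolution/Lipman1969IntersectionTheoryRational`) and the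
additivity of `excCurveDegree` along `[IJ] ∼ [I] + [J]` (`𝒪(−D−E) = 𝒪(−D)𝒪(−E)`,
`Resolution/EffectiveDivisorIdealSheafProduct`).

* `sameDivisor_ofIsEffectiveCartier_mul` — `[IJ] ∼ [I] + [J]`;
* `excCurveDegree_ofIsEffectiveCartier_top` — `[(1)]` has degree `0`;
* **`excCurveDegree_prod_eq_h0`** — the displayed formula (given `H¹(X, 𝒪_X) = 0`);
* **`excCurveDegree_prod_eq_h0_of_1_2`** — the same in the rational regime, modulo Prop. (1.2).

## References
* J. Lipman, Publ. Math. IHÉS 36 (1969), §13 Prop. (13.1) d) (p. 223). [Lipman1969]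
* U. Görtz, T. Wedhorn, *Algebraic Geometry I* (2nd ed. 2020), (11.9), Remark 11.27. [GortzWedhorn2020]
-/

noncomputable section

open CategoryTheory AlgebraicGeometry TopologicalSpace IsLocalRing Opposite
open Literature.AlgebraicGeometry.Motives Literature.AlgebraicGeometry.Motives.RatFn
open Scheme.IdealSheafData

universe u

namespace Literature.AlgebraicGeometry.Resolution

/-! ## §1 `[IJ] ∼ [I] + [J]`, `[(1)] ∼ 0` -/

/-- **`[IJ] ∼ [I] + [J]`**: for invertible ideal sheaves `I`, `J` on an integral scheme, the effective Cartier divisor of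
`IJ` is the same divisor as the sum of those of `I` and `J` (both have ideal sheaf `IJ`).
[cite: GortzWedhorn2020, Section (11.9) and Remark 11.27 (pp. 374, 378)] -/
theorem sameDivisor_ofIsEffectiveCartier_mul {X : Scheme.{u}} [IsIntegral X] (I J : X.IdealSheafData)
    (hI : IsEffectiveCartier I) (hJ : IsEffectiveCartier J) (hIJ : IsEffectiveCartier (I * J)) :
    (CartierDivisor.ofIsEffectiveCartier (I * J) hIJ).SameDivisor
      (CartierDivisor.ofIsEffectiveCartier I hI + CartierDivisor.ofIsEffectiveCartier J hJ) := by
  refine CartierDivisor.SameDivisor.of_idealSheaf_eq (CartierDivisor.isEffective_ofIsEffectiveCartier _ hIJ)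
    ((CartierDivisor.isEffective_ofIsEffectiveCartier I hI).add (CartierDivisor.isEffective_ofIsEffectiveCartier J hJ)) ?_
  rw [idealSheaf_add_of_isEffective (CartierDivisor.isEffective_ofIsEffectiveCartier I hI)
    (CartierDivisor.isEffective_ofIsEffectiveCartier J hJ), CartierDivisor.idealSheaf_ofIsEffectiveCartier,
    CartierDivisor.idealSheaf_ofIsEffectiveCartier, CartierDivisor.idealSheaf_ofIsEffectiveCartier]

/-- **`[(1)]` has degree `0` on every exceptional curve**: the divisor of the unit ideal sheaf avoids every point, so
it is the same divisor as `div 1 = 0`. [cite: Lipman1969, Section 13 (p. 223)] -/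
theorem excCurveDegree_ofIsEffectiveCartier_top {T : Type u} [CommRing T] [IsLocalRing T] {X : Scheme.{u}}
    [IsIntegral X] [IsLocallyNoetherian X] (π : X ⟶ Spec (.of T)) [IsProper π] {η : X}
    (hη : η ∈ excCurvePoints π) (h1 : IsEffectiveCartier (1 : X.IdealSheafData)) :
    excCurveDegree π (CartierDivisor.ofIsEffectiveCartier (1 : X.IdealSheafData) h1) η = 0 := by
  have hsame : (CartierDivisor.ofIsEffectiveCartier (1 : X.IdealSheafData) h1).SameDivisor
      (CartierDivisor.principal 1 one_ne_zero) := by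
    intro i j x hi _
    have hav : (CartierDivisor.ofIsEffectiveCartier (1 : X.IdealSheafData) h1).Avoids x := by
      rw [CartierDivisor.avoids_ofIsEffectiveCartier_iff, one_eq_top, support_top]
      exact fun h => h
    change IsUnitAt x ((CartierDivisor.ofIsEffectiveCartier (1 : X.IdealSheafData) h1).f i / 1)
    rw [div_one]
    exact hav i hi
  rw [excCurveDegree_congr_linEquiv π hη hsame.linEquiv]
  exact excCurveDegree_principal π hη one_ne_zero

/-! ## §2 `(D·E) = h⁰(E) + h⁰(𝒪_D) − h⁰(𝒪_{D+E})` -/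

section Main

variable {A : Type u} [CommRing A] [IsNoetherianRing A] [IsLocalRing A] [IsDomain A]
  {X : Scheme.{u}} [IsIntegral X] [IsLocallyNoetherian X] (π : X ⟶ Spec (.of A))

/-- **Lipman 1969, Prop. (13.1) d) for an arbitrary effective exceptional divisor against an integral exceptional
curve, in `h⁰`-lengths**: on a resolution `π : X → Spec A` of a two-dimensional Noetherian local domain with
`H¹(X, 𝒪_X) = 0`, for `D = V(𝓛_t)`, `𝓛_t = ∏_{ζ∈t} 𝓘_ζ` (any multiset `t` of integral exceptional curves) and
`E = E_η`, `(D·E) = excCurveDegree π [𝓛_t] η = h0 𝓘_η + h0 𝓛_t − h0(𝓛_t 𝓘_η)` — `(F·E) = χ(E) + χ(F) − χ(E+F)` with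
`χ = h⁰`. [cite: Lipman1969, Proposition (13.1) d) (p. 223)] -/
theorem excCurveDegree_prod_eq_h0 (hA : ringKrullDim A = 2) (hπ : IsResolution π) (h1 : HasTrivialCechH1 π)
    (t : Multiset X) (ht : ∀ ζ ∈ t, ζ ∈ excCurvePoints π) {η : X} (hη : η ∈ excCurvePoints π)
    (hL : IsEffectiveCartier (t.map primeDivisorIdeal).prod) :
    excCurveDegree π (CartierDivisor.ofIsEffectiveCartier (t.map primeDivisorIdeal).prod hL) η =
      ((h0 π (primeDivisorIdeal η)).toNat : ℤ) + (h0 π (t.map primeDivisorIdeal).prod).toNat -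
        (h0 π ((t.map primeDivisorIdeal).prod * primeDivisorIdeal η)).toNat := by
  haveI : IsProper π := hπ.isProper
  have hX : Scheme.IsRegular X := hπ.isRegular
  have hco : ∀ ζ ∈ excCurvePoints π, Order.coheight ζ = 1 := fun ζ hζ => hπ.coheight_eq_one_of_mem_excCurvePoints hA hζ
  induction t using Multiset.induction_on with
  | empty =>
    revert hL
    rw [Multiset.map_zero, Multiset.prod_zero]
    intro hL
    rw [excCurveDegree_ofIsEffectiveCartier_top π hη hL, one_mul, h0_one, ENat.toNat_zero, Nat.cast_zero]
    ring
  | cons a t ih =>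
    have ha : a ∈ excCurvePoints π := ht a (Multiset.mem_cons_self a t)
    have ht' : ∀ ζ ∈ t, ζ ∈ excCurvePoints π := fun ζ hζ => ht ζ (Multiset.mem_cons_of_mem hζ)
    have hLt : IsEffectiveCartier (t.map primeDivisorIdeal).prod :=
      isEffectiveCartier_prod_primeDivisorIdeal hX t fun ζ hζ => hco ζ (ht' ζ hζ)
    have hFa : IsEffectiveCartier (primeDivisorIdeal a) := isEffectiveCartier_primeDivisorIdeal_of_isRegular hX (hco a ha)
    have ih' := ih ht' hLt
    -- `[𝓛_{a::t}] ∼ [𝓘_a] + [𝓛_t]`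
    have e : ((a ::ₘ t).map primeDivisorIdeal).prod = primeDivisorIdeal a * (t.map primeDivisorIdeal).prod := by
      rw [Multiset.map_cons, Multiset.prod_cons]
    revert hL
    rw [e]
    intro hL
    rw [excCurveDegree_congr_linEquiv π hη (sameDivisor_ofIsEffectiveCartier_mul _ _ hFa hLt hL).linEquiv,
      excCurveDegree_add π hη, ih', excCurveDegree_primeDivisor_eq_h0 π hA hπ h1 hη ha hFa]
    -- the `𝓛`-independence of `Δ_E(𝓛𝓘_a) − Δ_E(𝓛)`
    have step := h0_delta_step_indep π hA hπ h1 t ht' ha hη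
    rw [one_mul, one_mul, h0_one, ENat.toNat_zero, Nat.cast_zero] at step
    rw [mul_comm (primeDivisorIdeal a) (t.map primeDivisorIdeal).prod]
    linarith

/-- **The rational regime, modulo Prop. (1.2)**: `(D·E_η) = h0 𝓘_η + h0 𝓛_t − h0(𝓛_t 𝓘_η)` for every effective
exceptional divisor `D = V(𝓛_t)` on any desingularisation of a two-dimensional normal local domain with a rational
singularity. [cite: Lipman1969, Proposition (13.1) d) (p. 223)] -/
theorem excCurveDegree_prod_eq_h0_of_1_2 (h12 : Lipman1969_1_2.{u})
    {S : Type u} [CommRing S] [IsNoetherianRing S] [IsLocalRing S] [IsDomain S] [IsIntegrallyClosed S]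
    (hdim : ringKrullDim S = 2) (hrat : HasRationalSingularity S)
    {X : Scheme.{u}} [IsIntegral X] [IsLocallyNoetherian X] (π : X ⟶ Spec (.of S)) (hπ : IsResolution π)
    (t : Multiset X) (ht : ∀ ζ ∈ t, ζ ∈ excCurvePoints π) {η : X} (hη : η ∈ excCurvePoints π)
    (hL : IsEffectiveCartier (t.map primeDivisorIdeal).prod) :
    excCurveDegree π (CartierDivisor.ofIsEffectiveCartier (t.map primeDivisorIdeal).prod hL) η =
      ((h0 π (primeDivisorIdeal η)).toNat : ℤ) + (h0 π (t.map primeDivisorIdeal).prod).toNat -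
        (h0 π ((t.map primeDivisorIdeal).prod * primeDivisorIdeal η)).toNat :=
  excCurveDegree_prod_eq_h0 π hdim hπ (h12.hasTrivialCechH1_of_isResolution hdim hrat π hπ) t ht hη hL

end Main

end Literature.AlgebraicGeometry.Resolution

end
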